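import Summits.QuantumFields.YangMills.Theorems.UnitScaleTiltProp7TransverseRowOfQTwSTubeComparison
import Literature.MathematicalPhysics.QuantumFieldTheory.Balaban1983to89.B5Eq118OneStroke
import Literature.MathematicalPhysics.QuantumFieldTheory.Balaban1983to89.B5Eq117TorusCarriers
import Literature.MathematicalPhysics.QuantumFieldTheory.Balaban1983to89.B15Chi124DetSets
import Summits.QuantumFields.YangMills.Theorems.UnitScaleTiltProp7CompetitorEnergyMember
import HarnessLib

/-!
# Route `UnitScaleTilt`, crux «MinimiserStabilityRegPr» (stmt-QuantumFields-19200), stub `stub_existenceMinimalOrbit` (EX), positivity block behind `Lift` —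
# pen (b) of ★p1 g22's `LOCATE-GAMMA-ROW-p1g22.md` §3, FILE 2: **THE FLAT ANCHOR OF THE TUBE-COMPARISON ROW `hQcmp` OF ✓`Prop7TransverseRowOfQTwSTubeComparison`** —
# at the trivial background `U₀ = 1` the engine's corner-anchored straight tube sum IS `ℓ^d` times the averaging operator of record, EXACTLY:
# `T^{str}_1 Y(ĉ) = ℓ^d • QTwS 1 Y c`, hence the displayed row holds at `U₀ = 1` with ANY `Cq ≥ 0`, and (T)_Q holds there unconditionally.

Cell `ym3-torus`, twin-width seat `ym-ust-19200-w7` (gen 10).  THEOREMS ONLY (0 `def`, 0 `sorry`); `--supports stmt-QuantumFields-19200 --as helper`, count-neutral.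
YM₃ on T³ is ladder rung R3 — NOT d = 4, NOT infinite volume, NOT a mass gap, NOT Clay; nothing here claims the γ-row, a print row, the stub or the crux.

THE POINT.  ✓p740688 `…TransverseRowOfQTwSTubeComparison.sum_normSq_le_curl_sq_add_divB_sq_add_QTwS_of_tubeRow` displays ONE row
`hQcmp : Σ_c‖T^{str}_{U₀}Y(c)‖² ≤ 2(ℓ^d)²·Σ_{c'}‖QTwS U₀ Y c'‖² + Cq·ε²·(ℓ^dℓ²)·Σ_b‖Y_b‖²` (pen (b1), the curved transport comparison — NOT here).  This file is its NORMALISATION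
CERTIFICATE: (§1) along shift-iterates the engine's tube is the straight contour of `LatticeFieldCalculus.segSum`; (§2) at `U₀ = 1` every transporter is `1`
(`T3PrintedRegularMinimiser.unitsField_toUField_one`, `B10Eq27TorusAxialLog.holT_one`), so by the one-stroke formula ✓`B5Eq118OneStroke.bondAvgIter_eq_blockSum` ([Balaban1984PropagatorsI]
(1.18)) and the block re-indexing ✓`B5Eq117TorusCarriers.sum_iterBlock_eq` the tube sum is `(L^{d+1})^{K−n} • bondAvgIter (K−n) Y`; (§3) with (J2) ✓`Prop7SymAvgTwSym.QTwS_one_apply` (real ↦ complex scalars by ✓`Prop7CompetitorEnergyMember.real_smul_eq_coe_smul`)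
(`QTwS 1 Y c = ℓ • bondAvgIter (K−n) Y ĉ`, ℓ = L^{K−n}) this is `T^{str}_1 Y(ĉ) = (ℓ^d : ℂ) • QTwS 1 Y c` and `‖T^{str}_1 Y(ĉ)‖ = ℓ^d·‖QTwS 1 Y c‖`; (§4) summing over the comparison
bonds through the level bijection `T3LevelShift.bondShift (sites_eq F n K h)`: `Σ_c‖T^{str}_1 Y(c)‖² = (ℓ^d)²·Σ_{c'}‖QTwS 1 Y c'‖²` — so the row holds at `U₀ = 1` for every `Cq ≥ 0`, `ε`
(the factor `2` and the `ε²` term are the curved slack), and (§5) the transverse floor (T)_Q of ✓p740688 holds at `U₀ = 1` with no displayed row.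
HONEST SCOPE.  Flat bookkeeping only (`U₀ = 1`); the curved supplier of `hQcmp` (LEG ✓ + STRUCTURE ✓ + DEFECT ✓ + the tower∕corner transport comparison + the coarse-gauge residue) is the
open pen (b1).  Nothing of print is asserted.
References: T. Bałaban, CMP 95 (1984) 17–40 [Balaban1984PropagatorsI] ((1.11), (1.16)–(1.18) pp.19–20); CMP 98 (1985) 17–51 [Balaban1985Averaging] ((125)–(127) p.36);
CMP 99 (1985) 389–434 [Balaban1985BackgroundPropagators] (Thm 3.11 p.416, (3.14)–(3.15) p.393).
-/

set_option autoImplicit false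

noncomputable section

open scoped BigOperators Matrix.Norms.L2Operator Matrix

namespace Summit.QuantumFields.YangMills.Theorems.Prop7TubeComparisonRowFlat

open Literature.MathematicalPhysics.QuantumFieldTheory.Balaban1983to89
open Finset B1RG242Torus LatticeFieldCalculus
open B5Eq118OneStroke (iterBlock bondAvgIter_eq_blockSum)
open B7Prop1Explicit (treeWord)
open B7Eq78Linearization (conjR conjR_apply)
open B9Eq39Adjoint (curl divB)
open B10Eq27TorusAxialLog (holT unitsField toUField holT_one)
open B9TorusCalculus (torusT)
open T3ContinuumYM3Torus (T3Family)
open T3LevelShift (bondShift)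
open T3PrintedRegularOrbits (sites_eq)
open T3PrintedRegularMinimiser (unitsField_toUField_one)
open Summit.QuantumFields.YangMills.Theorems.Prop7TransverseRowOfQTwSTubeComparison (sum_normSq_le_curl_sq_add_divB_sq_add_QTwS_of_tubeRow)
open Summit.QuantumFields.YangMills.Theorems.Prop7SymAvgTwSym (QTwS QTwS_one_apply)
open Summit.QuantumFields.YangMills.Theorems.Prop7CompetitorEnergyMember (real_smul_eq_coe_smul)

/-! ## §1 The straight contour along shift-iterates -/

/-- The `t`-fold shift of a site in direction `μ` is the `t`-th site `x + t e_μ` of the straight contour (`LatticeFieldCalculus.runSite`).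
[cite: Balaban1984PropagatorsI, (1.7) p.18] -/
theorem iterate_shift_eq_runSite {P : Params} {j : ℕ} (x : Site P j) (μ : Fin P.d) :
    ∀ t : ℕ, (fun z : Site P j => z.shift μ)^[t] x = runSite x μ t
  | 0 => by
    simp only [Function.iterate_zero, id_eq, runSite, Nat.cast_zero, add_zero, Function.update_eq_self]
  | t + 1 => by
    rw [Function.iterate_succ_apply', iterate_shift_eq_runSite x μ t, runSite_succ]

/-- `conjR 1 = id`. [folklore] -/
theorem conjR_one_left {𝔸 : Type*} [NormedRing 𝔸] [NormedAlgebra ℂ 𝔸] (X : 𝔸) : conjR (1 : 𝔸ˣ) X = X := by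
  rw [conjR_apply, inv_one, Units.val_one, one_mul, mul_one]

variable (F : T3Family) (n K : ℕ)

/-! ## §2 At `U₀ = 1` the engine's tube sum is `(L^{d+1})^{K−n} • bondAvgIter (K−n)` -/

/-- **THE CORNER TUBE AT THE TRIVIAL BACKGROUND IS THE ITERATED BOND AVERAGE** ([Balaban1984PropagatorsI] (1.18) read backwards): every transporter of the engine's tube
functional is `1` at `U₀ = 1`, and the remaining plain sum over the block of order `K − n` and the straight contours of length `L^{K−n}` is `(L^{d+1})^{K−n}` times
`bondAvgIter (K−n) Y`. [cite: Balaban1984PropagatorsI, (1.18) p.20] -/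
theorem tubeStr_one_eq_smul_bondAvgIter (Y : PBond (F.P K) 0 → Matrix (Fin 2) (Fin 2) ℂ) (c : PBond (F.P K) (K - n)) :
    ∑ r : Fin (F.P K).d → Fin ((F.P K).L ^ (K - n)), ∑ t ∈ range ((F.P K).L ^ (K - n)),
        conjR (holT (unitsField (toUField (1 : GaugeField (F.P K) 0 (Matrix.specialUnitaryGroup (Fin 2) ℂ))))
                (Site.fibreSite 0 (K - n) c.src fun _ => ⟨0, pow_pos (F.P K).L_pos (K - n)⟩) (treeWord fun ν => ((r ν : ℕ) : ℤ))
            * holT (unitsField (toUField (1 : GaugeField (F.P K) 0 (Matrix.specialUnitaryGroup (Fin 2) ℂ))))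
                (Site.fibreSite 0 (K - n) c.src r) (List.replicate t (c.dir, true)))
          (Y ⟨(fun z : Site (F.P K) 0 => z.shift c.dir)^[t] (Site.fibreSite 0 (K - n) c.src r), c.dir⟩)
      = ((((F.P K).L : ℝ) ^ ((F.P K).d + 1)) ^ (K - n)) • bondAvgIter (K - n) Y c := by
  have hk : K - n ≤ (F.P K).m + (F.P K).K := by show K - n ≤ F.m + K; omega
  -- every transporter is `1`
  simp only [unitsField_toUField_one, holT_one, one_mul, conjR_one_left, iterate_shift_eq_runSite]
  -- the plain tube sum is the block sum of straight contours
  have hseg : ∀ r : Fin (F.P K).d → Fin ((F.P K).L ^ (K - n)),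
      ∑ t ∈ range ((F.P K).L ^ (K - n)), Y ⟨runSite (Site.fibreSite 0 (K - n) c.src r) c.dir t, c.dir⟩
        = segSum Y (Site.fibreSite 0 (K - n) c.src r) c.dir ((F.P K).L ^ (K - n)) := fun r => rfl
  simp only [hseg]
  -- re-index the offsets as the block of order `K − n` (`blockSiteK ≡ Site.fibreSite 0` definitionally)
  have hsum : ∑ r : Fin (F.P K).d → Fin ((F.P K).L ^ (K - n)), segSum Y (Site.fibreSite 0 (K - n) c.src r) c.dir ((F.P K).L ^ (K - n))
      = ∑ x ∈ iterBlock (K - n) c.src, segSum Y x c.dir ((F.P K).L ^ (K - n)) :=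
    (B5Eq117TorusCarriers.sum_iterBlock_eq hk c.src (fun x => segSum Y x c.dir ((F.P K).L ^ (K - n)))).symm
  rw [hsum, bondAvgIter_eq_blockSum (K - n) hk Y c, smul_smul, mul_inv_cancel₀ (by have := (F.P K).L_pos; positivity), one_smul]

variable (h : n ≤ K)

/-! ## §3 … hence `ℓ^d` times the averaging operator of record at `U₀ = 1` -/

/-- **`T^{str}_1 Y(ĉ) = (ℓ^d : ℂ) • QTwS 1 Y c`** (`ℓ = L^{K−n}`, `ĉ = bondShift (sites_eq F n K h) c`): §2 and (J2) ✓`QTwS_one_apply` (`QTwS 1 Y c = ℓ • bondAvgIter (K−n) Y ĉ`).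
[cite: Balaban1984PropagatorsI, (1.18) p.20; Balaban1985Averaging, (125)-(127) p.36] -/
theorem tubeStr_one_eq_smul_QTwS_one (Y : PBond (F.P K) 0 → Matrix (Fin 2) (Fin 2) ℂ) (c : PBond (F.P n) 0) :
    ∑ r : Fin (F.P K).d → Fin ((F.P K).L ^ (K - n)), ∑ t ∈ range ((F.P K).L ^ (K - n)),
        conjR (holT (unitsField (toUField (1 : GaugeField (F.P K) 0 (Matrix.specialUnitaryGroup (Fin 2) ℂ))))
                (Site.fibreSite 0 (K - n) (bondShift (sites_eq F n K h) c).src fun _ => ⟨0, pow_pos (F.P K).L_pos (K - n)⟩) (treeWord fun ν => ((r ν : ℕ) : ℤ))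
            * holT (unitsField (toUField (1 : GaugeField (F.P K) 0 (Matrix.specialUnitaryGroup (Fin 2) ℂ))))
                (Site.fibreSite 0 (K - n) (bondShift (sites_eq F n K h) c).src r) (List.replicate t ((bondShift (sites_eq F n K h) c).dir, true)))
          (Y ⟨(fun z : Site (F.P K) 0 => z.shift (bondShift (sites_eq F n K h) c).dir)^[t] (Site.fibreSite 0 (K - n) (bondShift (sites_eq F n K h) c).src r),
              (bondShift (sites_eq F n K h) c).dir⟩)
      = (((((F.P K).L : ℂ) ^ (K - n)) ^ (F.P K).d)) • QTwS F n K h 1 Y c := by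
  rw [tubeStr_one_eq_smul_bondAvgIter F n K Y (bondShift (sites_eq F n K h) c), QTwS_one_apply (F := F) (n := n) (K := K) (h := h), real_smul_eq_coe_smul, smul_smul]
  congr 1
  push_cast
  ring

/-- **NORM FORM**: `‖T^{str}_1 Y(ĉ)‖ = ℓ^d · ‖QTwS 1 Y c‖`. [cite: Balaban1984PropagatorsI, (1.18) p.20] -/
theorem norm_tubeStr_one_eq (Y : PBond (F.P K) 0 → Matrix (Fin 2) (Fin 2) ℂ) (c : PBond (F.P n) 0) :
    ‖∑ r : Fin (F.P K).d → Fin ((F.P K).L ^ (K - n)), ∑ t ∈ range ((F.P K).L ^ (K - n)),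
        conjR (holT (unitsField (toUField (1 : GaugeField (F.P K) 0 (Matrix.specialUnitaryGroup (Fin 2) ℂ))))
                (Site.fibreSite 0 (K - n) (bondShift (sites_eq F n K h) c).src fun _ => ⟨0, pow_pos (F.P K).L_pos (K - n)⟩) (treeWord fun ν => ((r ν : ℕ) : ℤ))
            * holT (unitsField (toUField (1 : GaugeField (F.P K) 0 (Matrix.specialUnitaryGroup (Fin 2) ℂ))))
                (Site.fibreSite 0 (K - n) (bondShift (sites_eq F n K h) c).src r) (List.replicate t ((bondShift (sites_eq F n K h) c).dir, true)))
          (Y ⟨(fun z : Site (F.P K) 0 => z.shift (bondShift (sites_eq F n K h) c).dir)^[t] (Site.fibreSite 0 (K - n) (bondShift (sites_eq F n K h) c).src r),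
              (bondShift (sites_eq F n K h) c).dir⟩)‖
      = (((F.L : ℝ) ^ (K - n)) ^ (F.P K).d) * ‖QTwS F n K h 1 Y c‖ := by
  rw [tubeStr_one_eq_smul_QTwS_one F n K h, norm_smul]
  congr 1
  have hLF : ((F.P K).L : ℂ) = ((F.L : ℝ) : ℂ) := by norm_cast
  rw [hLF, ← Complex.ofReal_pow, ← Complex.ofReal_pow, Complex.norm_real, Real.norm_of_nonneg (by positivity)]

/-- **NORM FORM ON THE FINE-LATTICE INDEX**: for a coarse bond `c` of the fine torus, `‖T^{str}_1 Y(c)‖ = ℓ^d · ‖QTwS 1 Y (bondShift⁻¹ c)‖`. [cite: Balaban1984PropagatorsI, (1.18) p.20] -/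
theorem norm_tubeStr_one_eq_symm (Y : PBond (F.P K) 0 → Matrix (Fin 2) (Fin 2) ℂ) (c : PBond (F.P K) (K - n)) :
    ‖∑ r : Fin (F.P K).d → Fin ((F.P K).L ^ (K - n)), ∑ t ∈ range ((F.P K).L ^ (K - n)),
        conjR (holT (unitsField (toUField (1 : GaugeField (F.P K) 0 (Matrix.specialUnitaryGroup (Fin 2) ℂ))))
                (Site.fibreSite 0 (K - n) c.src fun _ => ⟨0, pow_pos (F.P K).L_pos (K - n)⟩) (treeWord fun ν => ((r ν : ℕ) : ℤ))
            * holT (unitsField (toUField (1 : GaugeField (F.P K) 0 (Matrix.specialUnitaryGroup (Fin 2) ℂ))))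
                (Site.fibreSite 0 (K - n) c.src r) (List.replicate t (c.dir, true)))
          (Y ⟨(fun z : Site (F.P K) 0 => z.shift c.dir)^[t] (Site.fibreSite 0 (K - n) c.src r), c.dir⟩)‖
      = (((F.L : ℝ) ^ (K - n)) ^ (F.P K).d) * ‖QTwS F n K h 1 Y ((bondShift (sites_eq F n K h)).symm c)‖ := by
  have h3 := norm_tubeStr_one_eq F n K h Y ((bondShift (sites_eq F n K h)).symm c)
  simp only [Equiv.apply_symm_apply] at h3
  exact h3

/-! ## §4 The displayed row `hQcmp` of ✓p740688 HOLDS at `U₀ = 1` (any `Cq ≥ 0`, any `ε`) -/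

/-- **THE FLAT ANCHOR OF `hQcmp`**: at `U₀ = 1`, `Σ_c‖T^{str}_1 Y(c)‖² = (ℓ^d)²·Σ_{c'}‖QTwS 1 Y c'‖²` (§3 summed through the level bijection `bondShift (sites_eq F n K h)`), so the
row holds with the curved slack (`2×`, `+ Cq·ε²·(ℓ^dℓ²)·Σ‖Y‖²`) to spare. [cite: Balaban1984PropagatorsI, (1.18) p.20; Balaban1985BackgroundPropagators, (3.14)-(3.15) p.393] -/
theorem tubeRow_one (Y : PBond (F.P K) 0 → Matrix (Fin 2) (Fin 2) ℂ) {Cq : ℝ} (hCq : 0 ≤ Cq) (ε : ℝ) :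
    ∑ c : PBond (F.P K) (K - n), ‖∑ r : Fin (F.P K).d → Fin ((F.P K).L ^ (K - n)), ∑ t ∈ range ((F.P K).L ^ (K - n)),
        conjR (holT (unitsField (toUField (1 : GaugeField (F.P K) 0 (Matrix.specialUnitaryGroup (Fin 2) ℂ))))
                (Site.fibreSite 0 (K - n) c.src fun _ => ⟨0, pow_pos (F.P K).L_pos (K - n)⟩) (treeWord fun ν => ((r ν : ℕ) : ℤ))
            * holT (unitsField (toUField (1 : GaugeField (F.P K) 0 (Matrix.specialUnitaryGroup (Fin 2) ℂ))))
                (Site.fibreSite 0 (K - n) c.src r) (List.replicate t (c.dir, true)))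
          (Y ⟨(fun z : Site (F.P K) 0 => z.shift c.dir)^[t] (Site.fibreSite 0 (K - n) c.src r), c.dir⟩)‖ ^ 2
      ≤ 2 * (((F.L : ℝ) ^ (K - n)) ^ (F.P K).d) ^ 2 * ∑ c' : PBond (F.P n) 0, ‖QTwS F n K h 1 Y c'‖ ^ 2
        + Cq * ε ^ 2 * (((F.L : ℝ) ^ (K - n)) ^ (F.P K).d * ((F.L : ℝ) ^ (K - n)) ^ 2) * ∑ b : PBond (F.P K) 0, ‖Y b‖ ^ 2 := by
  -- §3 bondwise on the fine-lattice index, then the level bijection on the `QTwS` side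
  have hre : (∑ c : PBond (F.P K) (K - n), ‖QTwS F n K h 1 Y ((bondShift (sites_eq F n K h)).symm c)‖ ^ 2)
      = ∑ c' : PBond (F.P n) 0, ‖QTwS F n K h 1 Y c'‖ ^ 2 :=
    Equiv.sum_comp (bondShift (sites_eq F n K h)).symm (fun c' => ‖QTwS F n K h 1 Y c'‖ ^ 2)
  simp only [norm_tubeStr_one_eq_symm F n K h Y, mul_pow]
  rw [← Finset.mul_sum, hre]
  have hQ : 0 ≤ (((F.L : ℝ) ^ (K - n)) ^ (F.P K).d) ^ 2 * ∑ c' : PBond (F.P n) 0, ‖QTwS F n K h 1 Y c'‖ ^ 2 := by positivity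
  have hS : 0 ≤ Cq * ε ^ 2 * (((F.L : ℝ) ^ (K - n)) ^ (F.P K).d * ((F.L : ℝ) ^ (K - n)) ^ 2) * ∑ b : PBond (F.P K) 0, ‖Y b‖ ^ 2 := by
    have : 0 ≤ ε ^ 2 := sq_nonneg ε
    positivity
  refine le_add_of_le_of_nonneg ?_ hS
  rw [mul_assoc]
  exact le_mul_of_one_le_left hQ one_le_two

/-! ## §5 (T)_Q at the trivial background, unconditionally -/

/-- **(T)_Q AT `U₀ = 1`, NO DISPLAYED ROW**: `ℓ⁻²Σ_b‖Y_b‖² ≤ 18(Σ‖curl Y‖² + Σ‖div Y‖²) + 32(ℓ^dℓ²)⁻¹ℓ⁻²(ℓ^d)²·Σ_{c'}‖QTwS 1 Y c'‖²` — ✓p740688 with `hQcmp := tubeRow_one` (`Cq = 0`),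
the plaquette hypothesis holding trivially (`1(∂p) = 1`, `dist1 1 = 0`). [cite: Balaban1985BackgroundPropagators, Thm 3.11 p.416] -/
theorem sum_normSq_le_curl_sq_add_divB_sq_add_QTwS_one (Y : PBond (F.P K) 0 → Matrix (Fin 2) (Fin 2) ℂ) :
    (((F.L : ℝ) ^ (K - n)) ^ 2)⁻¹ * ∑ b : PBond (F.P K) 0, ‖Y b‖ ^ 2
      ≤ 18 * (∑ x : Site (F.P K) 0, ∑ μ : Fin (F.P K).d, ∑ ν : Fin (F.P K).d,
            (if μ < ν then ∑ j : Fin 2, ∑ k : Fin 2,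
              ‖(curl (torusT (F.P K) 0) (fun κ z => unitsField (toUField (1 : GaugeField (F.P K) 0 (Matrix.specialUnitaryGroup (Fin 2) ℂ))) ⟨z, κ⟩)
                (fun κ z => Y ⟨z, κ⟩) μ ν x) j k‖ ^ 2 else 0)
          + ∑ x : Site (F.P K) 0, ∑ j : Fin 2, ∑ k : Fin 2,
              ‖(divB (torusT (F.P K) 0) (fun κ z => unitsField (toUField (1 : GaugeField (F.P K) 0 (Matrix.specialUnitaryGroup (Fin 2) ℂ))) ⟨z, κ⟩)
                (fun κ z => Y ⟨z, κ⟩) x) j k‖ ^ 2)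
        + 32 * (((((F.L : ℝ) ^ (K - n)) ^ (F.P K).d) * ((F.L : ℝ) ^ (K - n)) ^ 2)⁻¹ * (((F.L : ℝ) ^ (K - n)) ^ 2)⁻¹)
          * (((F.L : ℝ) ^ (K - n)) ^ (F.P K).d) ^ 2 * ∑ c' : PBond (F.P n) 0, ‖QTwS F n K h 1 Y c'‖ ^ 2 := by
  have hU : ∀ p : Plaq (F.P K) 0, dist1 (GaugeField.plaqHol (1 : GaugeField (F.P K) 0 (Matrix.specialUnitaryGroup (Fin 2) ℂ)) p)
      ≤ 0 * (((F.L : ℝ) ^ (K - n)) ^ 2)⁻¹ := fun p => by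
    rw [B15Chi124DetSets.plaqHol_one, GaugeGroup.dist1_one, zero_mul]
  have hrow := tubeRow_one F n K h Y (le_refl (0 : ℝ)) 0
  have hT := sum_normSq_le_curl_sq_add_divB_sq_add_QTwS_of_tubeRow F n K h 1 (le_refl (0 : ℝ)) (by norm_num) hU Y 0 hrow
  have e : (1 - 16 * (0 : ℝ) * 0 ^ 2) = 1 := by norm_num
  rw [e, one_mul] at hT
  exact hT

end Summit.QuantumFields.YangMills.Theorems.Prop7TubeComparisonRowFlat

end
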